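import Summits.AtomisticToContinuum.Crystallization.Theorems.FrustratedLawDichotomyCollarNonExempt
import Literature.Algebra.EuclideanLattices.FccBccLattices

/-!
# FrustratedLawDichotomy · crux `AperiodicFrustratedLawGap` (stmt-AtomisticToContinuum-27623) — COORDINATE FORM of the move-test certificate
# hypotheses (decomp-a2c, prover hand 2, generation 16; critic row 578 (B)(1))

`…CollarNonExempt.not_moveUnstableCore_of_bregmanCert(_closed)` has three hypotheses that quantify over `ℝ³` or involve a norm:
`hA : ∀ v, λ‖v‖² ≤ S‖v‖² + 4 Σ_k c_k ⟪w_k, v⟫²`, `hB : ‖Σ_k (4c_k) • w_k‖ ≤ β`, `hF : ‖Σ_k (2Ṽ'(Q_k)) • w_k‖ ≤ φ_F`.  This file turns them into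
the finitely many COORDINATE inequalities a rational checker evaluates:

* §1 (coordinates from `Literature.Algebra.EuclideanLattices.inner_fin_three` / `norm_sq_fin_three`) `sum_smul_apply`, ★ `norm_sum_smul_le_of_coords` (`hB`/`hF` from `β ≥ 0` and `Σ_i (Σ_k a_k w_k i)² ≤ β²`);
* §2 ★ `quadForm_ge_of_ldl` — a 3×3 symmetric matrix `M` with an `LDLᵀ` factorisation of `M − λI` with `D ≥ 0` (six identities, three signs) has
  `λ‖v‖² ≤ vᵀMv`; ★ `hA_of_ldl` — `hA` for the certificate matrix `A = S·I + 4 Σ_k c_k w_k w_kᵀ` from such a factorisation of its six entries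
  (`sum_mul_inner_sq_eq_coords`: `Σ_k c_k ⟪w_k, v⟫²` in coordinates).
All `[folklore]`; 0 sorry.
-/

noncomputable section

namespace Summit.AtomisticToContinuum.Crystallization.Theorems.FrustratedLawDichotomyCollarNonExemptCoords

open scoped BigOperators RealInnerProductSpace
open Literature.Algebra.EuclideanLattices (inner_fin_three norm_sq_fin_three)

/-! ## §1. Coordinates on `ℝ³` and the two norm hypotheses -/

/-- A norm bound from coordinates: `0 ≤ β`, `x₀² + x₁² + x₂² ≤ β²` ⟹ `‖x‖ ≤ β`. [folklore] -/
theorem norm_le_of_coords {x : EuclideanSpace ℝ (Fin 3)} {β : ℝ} (hβ : 0 ≤ β) (h : x 0 ^ 2 + x 1 ^ 2 + x 2 ^ 2 ≤ β ^ 2) : ‖x‖ ≤ β := by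
  rw [← norm_sq_fin_three] at h
  exact (pow_le_pow_iff_left₀ (norm_nonneg x) hβ two_ne_zero).1 h

/-- Components of a weighted sum of vectors. [folklore] -/
theorem sum_smul_apply {N : ℕ} (s : Finset (Fin N)) (a : Fin N → ℝ) (w : Fin N → EuclideanSpace ℝ (Fin 3)) (i : Fin 3) :
    (∑ k ∈ s, a k • w k) i = ∑ k ∈ s, a k * w k i := by
  simp [WithLp.ofLp_sum, Finset.sum_apply]

/-- ★ **`hB` / `hF` in coordinates**: `‖Σ_k a_k • w_k‖ ≤ β` from `0 ≤ β` and `Σ_i (Σ_k a_k w_k i)² ≤ β²` — three rational sums and one comparison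
for a rational checker. [folklore] -/
theorem norm_sum_smul_le_of_coords {N : ℕ} (s : Finset (Fin N)) (a : Fin N → ℝ) (w : Fin N → EuclideanSpace ℝ (Fin 3)) {β : ℝ} (hβ : 0 ≤ β)
    (h : (∑ k ∈ s, a k * w k 0) ^ 2 + (∑ k ∈ s, a k * w k 1) ^ 2 + (∑ k ∈ s, a k * w k 2) ^ 2 ≤ β ^ 2) :
    ‖∑ k ∈ s, a k • w k‖ ≤ β := by
  refine norm_le_of_coords hβ ?_
  rw [sum_smul_apply, sum_smul_apply, sum_smul_apply]
  exact h

/-! ## §2. The quadratic-form hypothesis from an `LDLᵀ` certificate -/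

/-- ★ **3×3 `LDLᵀ` certificate**: if `M − λI = L D Lᵀ` with unit lower-triangular `L = [[1,0,0],[l₁₀,1,0],[l₂₀,l₂₁,1]]` and `D = diag(d₀,d₁,d₂) ≥ 0`
(the six entry identities below), then `λ(v₀² + v₁² + v₂²) ≤ vᵀ M v`. [folklore] -/
theorem quadForm_ge_of_ldl {m00 m01 m02 m11 m12 m22 lam l10 l20 l21 d0 d1 d2 : ℝ} (hd0 : 0 ≤ d0) (hd1 : 0 ≤ d1) (hd2 : 0 ≤ d2)
    (h00 : m00 - lam = d0) (h01 : m01 = l10 * d0) (h02 : m02 = l20 * d0) (h11 : m11 - lam = l10 ^ 2 * d0 + d1)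
    (h12 : m12 = l20 * l10 * d0 + l21 * d1) (h22 : m22 - lam = l20 ^ 2 * d0 + l21 ^ 2 * d1 + d2) (v0 v1 v2 : ℝ) :
    lam * (v0 ^ 2 + v1 ^ 2 + v2 ^ 2) ≤
      m00 * v0 ^ 2 + m11 * v1 ^ 2 + m22 * v2 ^ 2 + 2 * (m01 * v0 * v1 + m02 * v0 * v2 + m12 * v1 * v2) := by
  have key : m00 * v0 ^ 2 + m11 * v1 ^ 2 + m22 * v2 ^ 2 + 2 * (m01 * v0 * v1 + m02 * v0 * v2 + m12 * v1 * v2) -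
      lam * (v0 ^ 2 + v1 ^ 2 + v2 ^ 2) =
      d0 * (v0 + l10 * v1 + l20 * v2) ^ 2 + d1 * (v1 + l21 * v2) ^ 2 + d2 * v2 ^ 2 := by
    have e00 : m00 = d0 + lam := by linarith
    have e11 : m11 = l10 ^ 2 * d0 + d1 + lam := by linarith
    have e22 : m22 = l20 ^ 2 * d0 + l21 ^ 2 * d1 + d2 + lam := by linarith
    rw [e00, e11, e22, h01, h02, h12]; ring
  have h1 : 0 ≤ d0 * (v0 + l10 * v1 + l20 * v2) ^ 2 := mul_nonneg hd0 (sq_nonneg _)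
  have h2 : 0 ≤ d1 * (v1 + l21 * v2) ^ 2 := mul_nonneg hd1 (sq_nonneg _)
  have h3 : 0 ≤ d2 * v2 ^ 2 := mul_nonneg hd2 (sq_nonneg _)
  linarith

/-- `Σ_k c_k ⟪w_k, v⟫²` in coordinates: a quadratic form in `v` with the six entry sums `Σ_k c_k w_k i w_k j`. [folklore] -/
theorem sum_mul_inner_sq_eq_coords {N : ℕ} (s : Finset (Fin N)) (c : Fin N → ℝ) (w : Fin N → EuclideanSpace ℝ (Fin 3))
    (v : EuclideanSpace ℝ (Fin 3)) :
    ∑ k ∈ s, c k * ⟪w k, v⟫ ^ 2 =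
      (∑ k ∈ s, c k * w k 0 ^ 2) * v 0 ^ 2 + (∑ k ∈ s, c k * w k 1 ^ 2) * v 1 ^ 2 + (∑ k ∈ s, c k * w k 2 ^ 2) * v 2 ^ 2 +
        2 * ((∑ k ∈ s, c k * (w k 0 * w k 1)) * v 0 * v 1 + (∑ k ∈ s, c k * (w k 0 * w k 2)) * v 0 * v 2 +
          (∑ k ∈ s, c k * (w k 1 * w k 2)) * v 1 * v 2) := by
  simp only [mul_add, Finset.sum_mul, Finset.mul_sum, ← Finset.sum_add_distrib]
  refine Finset.sum_congr rfl fun k _ => ?_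
  rw [inner_fin_three]; ring

/-- ★★ **`hA` from an `LDLᵀ` certificate of the certificate matrix `A = S·I + 4 Σ_k c_k w_k w_kᵀ`**: with the six entry sums
`a_ij = S·δ_ij + 4 Σ_k c_k w_k i w_k j` and `A − λI = LDLᵀ`, `D ≥ 0`, the hypothesis `hA` of `…CollarNonExempt.not_moveUnstableCore_of_bregmanCert` holds:
`∀ v, λ‖v‖² ≤ S‖v‖² + 4 Σ_k c_k ⟪w_k, v⟫²`. [folklore] -/
theorem hA_of_ldl {N : ℕ} (s : Finset (Fin N)) (c : Fin N → ℝ) (w : Fin N → EuclideanSpace ℝ (Fin 3)) {S lam l10 l20 l21 d0 d1 d2 : ℝ}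
    (hd0 : 0 ≤ d0) (hd1 : 0 ≤ d1) (hd2 : 0 ≤ d2)
    (h00 : S + 4 * (∑ k ∈ s, c k * w k 0 ^ 2) - lam = d0)
    (h01 : 4 * (∑ k ∈ s, c k * (w k 0 * w k 1)) = l10 * d0)
    (h02 : 4 * (∑ k ∈ s, c k * (w k 0 * w k 2)) = l20 * d0)
    (h11 : S + 4 * (∑ k ∈ s, c k * w k 1 ^ 2) - lam = l10 ^ 2 * d0 + d1)
    (h12 : 4 * (∑ k ∈ s, c k * (w k 1 * w k 2)) = l20 * l10 * d0 + l21 * d1)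
    (h22 : S + 4 * (∑ k ∈ s, c k * w k 2 ^ 2) - lam = l20 ^ 2 * d0 + l21 ^ 2 * d1 + d2) :
    ∀ v : EuclideanSpace ℝ (Fin 3), lam * ‖v‖ ^ 2 ≤ S * ‖v‖ ^ 2 + 4 * ∑ k ∈ s, c k * ⟪w k, v⟫ ^ 2 := by
  intro v
  have h := quadForm_ge_of_ldl hd0 hd1 hd2 h00 h01 h02 h11 h12 h22 (v 0) (v 1) (v 2)
  rw [norm_sq_fin_three, sum_mul_inner_sq_eq_coords]
  linarith

/-- ★ **The closed scalar condition in checker form**: `0 ≤ φ_F`, `0 ≤ β`, `L := λ − βs + min(C₄,0)s² > 0` and `φ_F² ≤ 4L(ε + σ)` are four rational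
comparisons once `λ, β, φ_F, C₄, s, ε, σ` are rational (`σ` = the slack literal); restated here only to fix the evaluation order for a checker:
`min(C₄, 0) = C₄` if `C₄ ≤ 0` else `0`. [folklore] -/
theorem closed_condition_of_cases {lam beta C4 s ε σ phiF : ℝ} (hC : (C4 ≤ 0 ∧ 0 < lam - beta * s + C4 * s ^ 2 ∧
      phiF ^ 2 ≤ 4 * (lam - beta * s + C4 * s ^ 2) * (ε + σ)) ∨ (0 ≤ C4 ∧ 0 < lam - beta * s ∧ phiF ^ 2 ≤ 4 * (lam - beta * s) * (ε + σ))) :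
    0 < lam - beta * s + min C4 0 * s ^ 2 ∧ phiF ^ 2 ≤ 4 * (lam - beta * s + min C4 0 * s ^ 2) * (ε + σ) := by
  rcases hC with ⟨hc, h1, h2⟩ | ⟨hc, h1, h2⟩
  · rw [min_eq_left hc]; exact ⟨h1, h2⟩
  · rw [min_eq_right hc, zero_mul, add_zero]; exact ⟨h1, h2⟩

end Summit.AtomisticToContinuum.Crystallization.Theorems.FrustratedLawDichotomyCollarNonExemptCoords

end
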